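import Mathlib
import HarnessLib

/-!
# Burgers-tube heredity, nonlinear part: the columnar swirl's flow map, its shear, and its
# Lyapunov spectrum `{σ, −σ/2, −σ/2}`

HONEST FRAMING (cell `ns-blowup`, seat `ns-blowup-instab2`; human ruling D-0035): nothing here is a
claim about Navier–Stokes blow-up. WHAT THIS IS NOT: not dynamics of any real flow; it is the
elementary calculus behind `HOME/instab2/HEREDITY-P3.md` LEMMA P3-L (A)(ii)–(iii) («swirl adds
rotation, not stretching»), the part that `BurgersTubeHeredity.lean` (p403782/p403971) left at paper
grade: there only the LINEARISED flow at the axis was written out.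

The columnar swirl in the parent's axisymmetric strain `σ > 0` is, in cylindrical coordinates,
`u = −(σ r/2) e_r + r Ω(r) e_θ + σ z e_z`, i.e. the trajectory ODEs `ṙ = −(σ/2) r`, `θ̇ = Ω(r)`,
`ż = σ z`, or in Cartesian components `ẋ = −(σ/2) x − Ω(r) y`, `ẏ = Ω(r) x − (σ/2) y`.

* `hasDerivAt_radius`, `hasDerivAt_angle`, `hasDerivAt_height`, `hasDerivAt_cartesian`: the EXPLICIT
  trajectories `r(t) = r₀ e^{−σt/2}`, `θ(t) = θ₀ + ∫₀ᵗ Ω(r₀ e^{−σs/2}) ds`, `z(t) = z₀ e^{σt}` solve these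
  ODEs for every continuous swirl profile `Ω` (so the flow map is known in closed form: (A)(ii)).
* `abs_integral_mul_exp_le`, `shear_sq_le`: the ONE off-diagonal entry of the flow-map differential in
  the co-moving orthonormal frame `(e_r, e_θ, e_z)` is `b(t) = r(t)·∂θ/∂r₀ = r₀ e^{−σt/2} ∫₀ᵗ Ω′(r₀e^{−σs/2})
  e^{−σs/2} ds` (chain rule under the integral — the memo's computation; here `g` stands for the
  bounded integrand `s ↦ Ω′(r₀ e^{−σs/2})`, `|g| ≤ M = sup |Ω′|`), and `|∫₀ᵗ g(s) e^{−σs/2} ds| ≤ (2M/σ)(1 −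
  e^{−σt/2}) ≤ 2M/σ`, whence `b² ≤ K² e^{−σt}` with the t-INDEPENDENT shear constant `K = 2 r₀ M/σ`
  (algebraic Lundgren winding, never an exponent).
* `transverse_energy_le`, `transverse_energy_ge`, `axial_energy_eq`, `columnar_jacobian_sandwich`:
  for the lower-triangular differential `T = !![a, 0, 0; b, a, 0; 0, 0, c]` with `b² ≤ K² a²` the image
  energies are sandwiched, `a²(v₀²+v₁²)/(2(1+K²)) ≤ (Tv)₀² + (Tv)₁² ≤ 2(1+K²) a²(v₀²+v₁²)` and
  `(Tv)₂² = c² v₂²`; with `a = e^{−σt/2}`, `c = e^{σt}` this is the statement that EVERY trajectory of the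
  columnar swirl has Lyapunov spectrum exactly the PARENT's `{σ, −σ/2, −σ/2}` for every swirl profile —
  differential rotation costs the bounded factor `2(1+K²)`, not an exponent ((A)(iii)). Consequence in
  the memo's words: a level-k Burgers tube offers a would-be child on, in or around it exactly the
  parent's stretching `σ = A_{k−1}`, never `A_k`.

Mathlib only. LABEL: MODEL/kinematic bookkeeping; the fluid reading is in the memo.
-/

namespace Summit.NavierStokesRegularity.FluidComputer.BurgersColumnarFlowMap

open Real MeasureTheory intervalIntegral Set Matrix

section Trajectories

/-! ### (A)(ii): the explicit trajectories solve the cylindrical and the Cartesian ODEs -/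

/-- Radial contraction at the parent's rate: `r(t) = r₀ e^{−σt/2}` solves `ṙ = −(σ/2) r`. -/
theorem hasDerivAt_radius (σ r₀ t : ℝ) :
    HasDerivAt (fun τ : ℝ => r₀ * Real.exp (-(σ / 2) * τ))
      (-(σ / 2) * (r₀ * Real.exp (-(σ / 2) * t))) t := by
  have h1 : HasDerivAt (fun τ : ℝ => -(σ / 2) * τ) (-(σ / 2)) t := by
    simpa using (hasDerivAt_id t).const_mul (-(σ / 2))
  have h2 : HasDerivAt (fun τ : ℝ => Real.exp (-(σ / 2) * τ))
      (Real.exp (-(σ / 2) * t) * (-(σ / 2))) t := h1.exp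
  exact (h2.const_mul r₀).congr_deriv (by ring)

/-- Axial stretching at the parent's rate: `z(t) = z₀ e^{σt}` solves `ż = σ z`. -/
theorem hasDerivAt_height (σ z₀ t : ℝ) :
    HasDerivAt (fun τ : ℝ => z₀ * Real.exp (σ * τ)) (σ * (z₀ * Real.exp (σ * t))) t := by
  have h1 : HasDerivAt (fun τ : ℝ => σ * τ) σ t := by
    simpa using (hasDerivAt_id t).const_mul σ
  have h2 : HasDerivAt (fun τ : ℝ => Real.exp (σ * τ)) (Real.exp (σ * t) * σ) t := h1.exp
  exact (h2.const_mul z₀).congr_deriv (by ring)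

/-- Differential rotation: `θ(t) = θ₀ + ∫₀ᵗ Ω(r₀ e^{−σs/2}) ds` solves `θ̇ = Ω(r(t))` for every
continuous swirl profile `Ω` (fundamental theorem of calculus). -/
theorem hasDerivAt_angle {Ω : ℝ → ℝ} (hΩ : Continuous Ω) (σ r₀ θ₀ t : ℝ) :
    HasDerivAt (fun τ : ℝ => θ₀ + ∫ s in (0 : ℝ)..τ, Ω (r₀ * Real.exp (-(σ / 2) * s)))
      (Ω (r₀ * Real.exp (-(σ / 2) * t))) t := by
  have hc : Continuous fun s : ℝ => Ω (r₀ * Real.exp (-(σ / 2) * s)) := by fun_prop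
  have h := (hc.integral_hasStrictDerivAt 0 t).hasDerivAt
  simpa using h.const_add θ₀

/-- The same trajectory in Cartesian components `x = r cos θ`, `y = r sin θ` solves
`ẋ = −(σ/2) x − Ω(r) y`, `ẏ = Ω(r) x − (σ/2) y` — the velocity field
`(u_x, u_y) = (−σx/2 − Ω(r) y, Ω(r) x − σy/2)` of `BurgersTubeHeredity.lean`'s header, now away from
the axis and without linearisation. -/
theorem hasDerivAt_cartesian {Ω : ℝ → ℝ} (hΩ : Continuous Ω) (σ r₀ θ₀ t : ℝ) :
    let r : ℝ → ℝ := fun τ => r₀ * Real.exp (-(σ / 2) * τ)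
    let θ : ℝ → ℝ := fun τ => θ₀ + ∫ s in (0 : ℝ)..τ, Ω (r₀ * Real.exp (-(σ / 2) * s))
    HasDerivAt (fun τ => r τ * Real.cos (θ τ))
        (-(σ / 2) * (r t * Real.cos (θ t)) - Ω (r t) * (r t * Real.sin (θ t))) t ∧
      HasDerivAt (fun τ => r τ * Real.sin (θ τ))
        (Ω (r t) * (r t * Real.cos (θ t)) - (σ / 2) * (r t * Real.sin (θ t))) t := by
  intro r θ
  have hr : HasDerivAt r (-(σ / 2) * r t) t := hasDerivAt_radius σ r₀ t
  have hθ : HasDerivAt θ (Ω (r t)) t := hasDerivAt_angle hΩ σ r₀ θ₀ t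
  refine ⟨?_, ?_⟩
  · exact (hr.mul hθ.cos).congr_deriv (by ring)
  · exact (hr.mul hθ.sin).congr_deriv (by ring)

end Trajectories

section Shear

/-! ### The shear entry: `∫₀ᵗ g(s) e^{−σs/2} ds` is bounded by `2M/σ` uniformly in `t` -/

/-- `∫₀ᵗ e^{λ s} ds = (e^{λ t} − 1)/λ` for `λ ≠ 0`. [folklore] -/
theorem integral_exp_mul (lam : ℝ) (hlam : lam ≠ 0) (t : ℝ) :
    ∫ s in (0 : ℝ)..t, Real.exp (lam * s) = (Real.exp (lam * t) - 1) / lam := by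
  have h : ∀ x ∈ uIcc (0 : ℝ) t,
      HasDerivAt (fun s => Real.exp (lam * s) / lam) (Real.exp (lam * x)) x := by
    intro x _
    have h1 : HasDerivAt (fun s : ℝ => lam * s) lam x := by
      simpa using (hasDerivAt_id x).const_mul lam
    have h2 : HasDerivAt (fun s : ℝ => Real.exp (lam * s)) (Real.exp (lam * x) * lam) x := h1.exp
    have h3 := h2.div_const lam
    rwa [mul_div_cancel_right₀ _ hlam] at h3
  have hint : IntervalIntegrable (fun s => Real.exp (lam * s)) volume (0 : ℝ) t :=
    (by fun_prop : Continuous fun s => Real.exp (lam * s)).intervalIntegrable _ _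
  rw [integral_eq_sub_of_hasDerivAt h hint]
  simp [sub_div]

/-- The weight integral: `∫₀ᵗ e^{−σs/2} ds = (2/σ)(1 − e^{−σt/2})`. -/
theorem integral_exp_neg_half (σ : ℝ) (hσ : σ ≠ 0) (t : ℝ) :
    ∫ s in (0 : ℝ)..t, Real.exp (-(σ / 2) * s) = 2 / σ * (1 - Real.exp (-(σ / 2) * t)) := by
  rw [integral_exp_mul (-(σ / 2)) (by simpa using hσ) t]
  field_simp
  ring

/-- **Shear bound (HEREDITY-P3 (A)(ii)).** If `|g| ≤ M` on `[0, t]` (`g` integrable; in the memo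
`g(s) = Ω′(r₀ e^{−σs/2})`, `M = sup |Ω′|`), then
`|∫₀ᵗ g(s) e^{−σs/2} ds| ≤ (2M/σ)(1 − e^{−σt/2})`. -/
theorem abs_integral_mul_exp_le {g : ℝ → ℝ} {M σ t : ℝ} (hσ : 0 < σ) (ht : 0 ≤ t)
    (hg : IntervalIntegrable g volume 0 t) (hM : ∀ s ∈ Icc (0 : ℝ) t, |g s| ≤ M) :
    |∫ s in (0 : ℝ)..t, g s * Real.exp (-(σ / 2) * s)|
      ≤ 2 * M / σ * (1 - Real.exp (-(σ / 2) * t)) := by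
  have hcw : Continuous fun s : ℝ => Real.exp (-(σ / 2) * s) := by fun_prop
  have hprod : IntervalIntegrable (fun s => g s * Real.exp (-(σ / 2) * s)) volume 0 t :=
    hg.mul_continuousOn hcw.continuousOn
  have h1 : |∫ s in (0 : ℝ)..t, g s * Real.exp (-(σ / 2) * s)|
      ≤ ∫ s in (0 : ℝ)..t, |g s * Real.exp (-(σ / 2) * s)| :=
    intervalIntegral.abs_integral_le_integral_abs ht
  have h2 : ∫ s in (0 : ℝ)..t, |g s * Real.exp (-(σ / 2) * s)|
      ≤ ∫ s in (0 : ℝ)..t, M * Real.exp (-(σ / 2) * s) := by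
    apply intervalIntegral.integral_mono_on ht hprod.abs
      ((continuous_const.mul hcw).intervalIntegrable _ _)
    intro s hs
    rw [abs_mul, abs_of_pos (Real.exp_pos _)]
    exact mul_le_mul_of_nonneg_right (hM s hs) (Real.exp_pos _).le
  have h3 : ∫ s in (0 : ℝ)..t, M * Real.exp (-(σ / 2) * s)
      = M * (2 / σ * (1 - Real.exp (-(σ / 2) * t))) := by
    rw [intervalIntegral.integral_const_mul, integral_exp_neg_half σ hσ.ne' t]
  calc |∫ s in (0 : ℝ)..t, g s * Real.exp (-(σ / 2) * s)|
      ≤ ∫ s in (0 : ℝ)..t, M * Real.exp (-(σ / 2) * s) := h1.trans h2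
    _ = 2 * M / σ * (1 - Real.exp (-(σ / 2) * t)) := by rw [h3]; ring

/-- Uniform-in-time form: `|∫₀ᵗ g(s) e^{−σs/2} ds| ≤ 2M/σ` (the winding saturates). -/
theorem abs_integral_mul_exp_le' {g : ℝ → ℝ} {M σ t : ℝ} (hσ : 0 < σ) (ht : 0 ≤ t)
    (hg : IntervalIntegrable g volume 0 t) (hM : ∀ s ∈ Icc (0 : ℝ) t, |g s| ≤ M) :
    |∫ s in (0 : ℝ)..t, g s * Real.exp (-(σ / 2) * s)| ≤ 2 * M / σ := by
  have hM0 : 0 ≤ M := (abs_nonneg _).trans (hM 0 ⟨le_rfl, ht⟩)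
  have he : 0 ≤ Real.exp (-(σ / 2) * t) := (Real.exp_pos _).le
  have hc : 0 ≤ 2 * M / σ := by positivity
  calc |∫ s in (0 : ℝ)..t, g s * Real.exp (-(σ / 2) * s)|
      ≤ 2 * M / σ * (1 - Real.exp (-(σ / 2) * t)) := abs_integral_mul_exp_le hσ ht hg hM
    _ ≤ 2 * M / σ * 1 := by gcongr; linarith
    _ = 2 * M / σ := mul_one _

/-- **The shear entry squared.** With `b(t) := r(t) · ∫₀ᵗ g e^{−σs/2} = r₀ e^{−σt/2} ∫₀ᵗ g(s) e^{−σs/2} ds`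
(the `(θ, r)` entry of the flow-map differential in the co-moving orthonormal frame), one has
`b² ≤ K² · (e^{−σt/2})²` with the t-independent constant `K = 2 r₀ M/σ`. -/
theorem shear_sq_le {g : ℝ → ℝ} {M σ t r₀ : ℝ} (hσ : 0 < σ) (ht : 0 ≤ t) (hr : 0 ≤ r₀)
    (hg : IntervalIntegrable g volume 0 t) (hM : ∀ s ∈ Icc (0 : ℝ) t, |g s| ≤ M) :
    (r₀ * Real.exp (-(σ / 2) * t) * ∫ s in (0 : ℝ)..t, g s * Real.exp (-(σ / 2) * s)) ^ 2
      ≤ (2 * r₀ * M / σ) ^ 2 * Real.exp (-(σ / 2) * t) ^ 2 := by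
  set I := ∫ s in (0 : ℝ)..t, g s * Real.exp (-(σ / 2) * s) with hI
  set a := Real.exp (-(σ / 2) * t) with ha
  have hIa : |I| ≤ 2 * M / σ := abs_integral_mul_exp_le' hσ ht hg hM
  have ha0 : 0 ≤ a := (Real.exp_pos _).le
  have hM0 : 0 ≤ M := (abs_nonneg _).trans (hM 0 ⟨le_rfl, ht⟩)
  have habs : |r₀ * a * I| ≤ 2 * r₀ * M / σ * a := by
    rw [abs_mul, abs_mul, abs_of_nonneg hr, abs_of_nonneg ha0]
    calc r₀ * a * |I| ≤ r₀ * a * (2 * M / σ) :=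
          mul_le_mul_of_nonneg_left hIa (mul_nonneg hr ha0)
      _ = 2 * r₀ * M / σ * a := by ring
  have hrhs : 0 ≤ 2 * r₀ * M / σ * a := by positivity
  calc (r₀ * a * I) ^ 2 = |r₀ * a * I| ^ 2 := (sq_abs _).symm
    _ ≤ (2 * r₀ * M / σ * a) ^ 2 := pow_le_pow_left₀ (abs_nonneg _) habs 2
    _ = (2 * r₀ * M / σ) ^ 2 * a ^ 2 := by ring

end Shear

section Jacobian

/-! ### (A)(iii): singular values of the lower-triangular differential `!![a, 0, 0; b, a, 0; 0, 0, c]` -/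

/-- The three components of `T v` for `T = !![a, 0, 0; b, a, 0; 0, 0, c]`. -/
theorem triangular_mulVec (a b c : ℝ) (v : Fin 3 → ℝ) :
    (!![a, 0, 0; b, a, 0; 0, 0, c] : Matrix (Fin 3) (Fin 3) ℝ).mulVec v 0 = a * v 0 ∧
      (!![a, 0, 0; b, a, 0; 0, 0, c] : Matrix (Fin 3) (Fin 3) ℝ).mulVec v 1 = b * v 0 + a * v 1 ∧
      (!![a, 0, 0; b, a, 0; 0, 0, c] : Matrix (Fin 3) (Fin 3) ℝ).mulVec v 2 = c * v 2 := by
  refine ⟨?_, ?_, ?_⟩ <;>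
    simp [Matrix.mulVec, dotProduct, Fin.sum_univ_three]

/-- Axial image energy: `(Tv)₂² = c² v₂²` exactly. -/
theorem axial_energy_eq (a b c : ℝ) (v : Fin 3 → ℝ) :
    ((!![a, 0, 0; b, a, 0; 0, 0, c] : Matrix (Fin 3) (Fin 3) ℝ).mulVec v 2) ^ 2 = c ^ 2 * v 2 ^ 2 := by
  rw [(triangular_mulVec a b c v).2.2]
  ring

/-- Transverse image energy, UPPER bound: `(Tv)₀² + (Tv)₁² ≤ 2(1+K²)·a²(v₀² + v₁²)` whenever the
shear entry obeys `b² ≤ K² a²`. -/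
theorem transverse_energy_le {a b K : ℝ} (c : ℝ) (hb : b ^ 2 ≤ K ^ 2 * a ^ 2) (v : Fin 3 → ℝ) :
    ((!![a, 0, 0; b, a, 0; 0, 0, c] : Matrix (Fin 3) (Fin 3) ℝ).mulVec v 0) ^ 2 +
        ((!![a, 0, 0; b, a, 0; 0, 0, c] : Matrix (Fin 3) (Fin 3) ℝ).mulVec v 1) ^ 2
      ≤ 2 * (1 + K ^ 2) * (a ^ 2 * (v 0 ^ 2 + v 1 ^ 2)) := by
  obtain ⟨h0, h1, -⟩ := triangular_mulVec a b c v
  rw [h0, h1]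
  have hsq : (b * v 0 + a * v 1) ^ 2 ≤ 2 * (b ^ 2 * v 0 ^ 2) + 2 * (a ^ 2 * v 1 ^ 2) := by
    nlinarith [sq_nonneg (b * v 0 - a * v 1)]
  have hbv : b ^ 2 * v 0 ^ 2 ≤ K ^ 2 * a ^ 2 * v 0 ^ 2 :=
    mul_le_mul_of_nonneg_right hb (sq_nonneg _)
  nlinarith [sq_nonneg a, sq_nonneg K, sq_nonneg (v 0), sq_nonneg (v 1),
    mul_nonneg (sq_nonneg K) (mul_nonneg (sq_nonneg a) (sq_nonneg (v 1)))]

/-- Transverse image energy, LOWER bound: `a²(v₀² + v₁²) ≤ 2(1+K²)·((Tv)₀² + (Tv)₁²)` whenever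
`b² ≤ K² a²` — the shear cannot contract the transverse plane faster than `a` up to the bounded factor. -/
theorem transverse_energy_ge {a b K : ℝ} (c : ℝ) (hb : b ^ 2 ≤ K ^ 2 * a ^ 2) (v : Fin 3 → ℝ) :
    a ^ 2 * (v 0 ^ 2 + v 1 ^ 2)
      ≤ 2 * (1 + K ^ 2) *
        (((!![a, 0, 0; b, a, 0; 0, 0, c] : Matrix (Fin 3) (Fin 3) ℝ).mulVec v 0) ^ 2 +
          ((!![a, 0, 0; b, a, 0; 0, 0, c] : Matrix (Fin 3) (Fin 3) ℝ).mulVec v 1) ^ 2) := by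
  obtain ⟨h0, h1, -⟩ := triangular_mulVec a b c v
  rw [h0, h1]
  have hsq : a ^ 2 * v 1 ^ 2 ≤ 2 * (b * v 0 + a * v 1) ^ 2 + 2 * (b ^ 2 * v 0 ^ 2) := by
    nlinarith [sq_nonneg (b * v 0 + a * v 1 + b * v 0), sq_nonneg (2 * b * v 0 + a * v 1)]
  have hbv : b ^ 2 * v 0 ^ 2 ≤ K ^ 2 * a ^ 2 * v 0 ^ 2 :=
    mul_le_mul_of_nonneg_right hb (sq_nonneg _)
  nlinarith [sq_nonneg a, sq_nonneg K, sq_nonneg (v 0), sq_nonneg (v 1), sq_nonneg (b * v 0 + a * v 1),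
    mul_nonneg (sq_nonneg K) (sq_nonneg (b * v 0 + a * v 1)),
    mul_nonneg (sq_nonneg K) (mul_nonneg (sq_nonneg a) (sq_nonneg (v 0)))]

/-- **HEREDITY-P3 (A)(iii), kernel form: the columnar swirl's Lyapunov spectrum is the parent's
`{σ, −σ/2, −σ/2}`.** Take the flow-map differential at time `t ≥ 0` in the co-moving orthonormal
frame, `T(t) = !![a, 0, 0; b, a, 0; 0, 0, c]` with `a = e^{−σt/2}`, `c = e^{σt}` and shear entry
`b = r₀ e^{−σt/2} ∫₀ᵗ g(s) e^{−σs/2} ds`, `|g| ≤ M` (`g = Ω′ ∘ r`, `M = sup|Ω′|`). Then for every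
tangent vector `v`, with `K = 2 r₀ M/σ`:
`e^{−σt}(v₀²+v₁²)/(2(1+K²)) ≤ (Tv)₀² + (Tv)₁² ≤ 2(1+K²) e^{−σt}(v₀²+v₁²)` and `(Tv)₂² = e^{2σt} v₂²` —
growth rates exactly `−σ/2` (twice) and `σ`, the swirl entering only through the t-independent
distortion factor `2(1+K²)`. -/
theorem columnar_jacobian_sandwich {g : ℝ → ℝ} {M σ t r₀ : ℝ} (hσ : 0 < σ) (ht : 0 ≤ t)
    (hr : 0 ≤ r₀) (hg : IntervalIntegrable g volume 0 t) (hM : ∀ s ∈ Icc (0 : ℝ) t, |g s| ≤ M)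
    (v : Fin 3 → ℝ) :
    let a := Real.exp (-(σ / 2) * t)
    let b := r₀ * Real.exp (-(σ / 2) * t) * ∫ s in (0 : ℝ)..t, g s * Real.exp (-(σ / 2) * s)
    let c := Real.exp (σ * t)
    let K := 2 * r₀ * M / σ
    let w := (!![a, 0, 0; b, a, 0; 0, 0, c] : Matrix (Fin 3) (Fin 3) ℝ).mulVec v
    Real.exp (-σ * t) * (v 0 ^ 2 + v 1 ^ 2) ≤ 2 * (1 + K ^ 2) * (w 0 ^ 2 + w 1 ^ 2) ∧
      w 0 ^ 2 + w 1 ^ 2 ≤ 2 * (1 + K ^ 2) * (Real.exp (-σ * t) * (v 0 ^ 2 + v 1 ^ 2)) ∧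
      w 2 ^ 2 = Real.exp (2 * σ * t) * v 2 ^ 2 := by
  intro a b c K w
  have hb : b ^ 2 ≤ K ^ 2 * a ^ 2 := shear_sq_le hσ ht hr hg hM
  have ha2 : a ^ 2 = Real.exp (-σ * t) := by
    show Real.exp (-(σ / 2) * t) ^ 2 = Real.exp (-σ * t)
    rw [← Real.exp_nat_mul]; congr 1; ring
  have hc2 : c ^ 2 = Real.exp (2 * σ * t) := by
    show Real.exp (σ * t) ^ 2 = Real.exp (2 * σ * t)
    rw [← Real.exp_nat_mul]; congr 1; ring
  refine ⟨?_, ?_, ?_⟩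
  · have h := transverse_energy_ge c hb v
    rwa [ha2] at h
  · have h := transverse_energy_le c hb v
    rwa [ha2] at h
  · have h := axial_energy_eq a b c v
    rwa [hc2] at h

end Jacobian

section SwirlDerivative

/-! ### The shear integrand identified: `∂θ/∂r₀ = ∫₀ᵗ Ω′(r₀ e^{−σs/2}) e^{−σs/2} ds` (chain rule under
the integral, for a `C¹` swirl profile with bounded derivative) -/

open Filter Topology in
/-- **Differentiating the winding angle in the initial radius.** For a swirl profile `Ω` with
continuous derivative `Ω′` bounded by `M`, the angle `θ(t; r₀) = θ₀ + ∫₀ᵗ Ω(r₀ e^{−σs/2}) ds` satisfies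
`∂θ/∂r₀ = ∫₀ᵗ Ω′(r₀ e^{−σs/2}) e^{−σs/2} ds` — the integrand `g(s) = Ω′(r₀ e^{−σs/2})` of the shear
bound, now derived rather than posited (dominated differentiation under the integral sign). -/
theorem hasDerivAt_angle_radius {Ω Ω' : ℝ → ℝ} (hΩ : ∀ x, HasDerivAt Ω (Ω' x) x)
    (hΩ' : Continuous Ω') {M : ℝ} (hM : ∀ x, |Ω' x| ≤ M) (σ θ₀ t r₀ : ℝ) :
    HasDerivAt (fun ρ : ℝ => θ₀ + ∫ s in (0 : ℝ)..t, Ω (ρ * Real.exp (-(σ / 2) * s)))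
      (∫ s in (0 : ℝ)..t, Ω' (r₀ * Real.exp (-(σ / 2) * s)) * Real.exp (-(σ / 2) * s)) r₀ := by
  have hΩc : Continuous Ω := continuous_iff_continuousAt.2 fun x => (hΩ x).continuousAt
  have hF_meas : ∀ᶠ ρ in 𝓝 r₀, AEStronglyMeasurable
      (fun s : ℝ => Ω (ρ * Real.exp (-(σ / 2) * s))) (volume.restrict (Set.uIoc (0 : ℝ) t)) :=
    Filter.Eventually.of_forall fun ρ =>
      (show Continuous fun s : ℝ => Ω (ρ * Real.exp (-(σ / 2) * s)) by fun_prop).aestronglyMeasurable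
  have hF_int : IntervalIntegrable (fun s : ℝ => Ω (r₀ * Real.exp (-(σ / 2) * s))) volume 0 t :=
    (show Continuous fun s : ℝ => Ω (r₀ * Real.exp (-(σ / 2) * s)) by fun_prop).intervalIntegrable _ _
  have hF'_meas : AEStronglyMeasurable
      (fun s : ℝ => Ω' (r₀ * Real.exp (-(σ / 2) * s)) * Real.exp (-(σ / 2) * s))
      (volume.restrict (Set.uIoc (0 : ℝ) t)) :=
    (show Continuous fun s : ℝ => Ω' (r₀ * Real.exp (-(σ / 2) * s)) * Real.exp (-(σ / 2) * s) by
      fun_prop).aestronglyMeasurable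
  have h_bound : ∀ᵐ s ∂volume, s ∈ Set.uIoc (0 : ℝ) t → ∀ ρ ∈ (univ : Set ℝ),
      ‖Ω' (ρ * Real.exp (-(σ / 2) * s)) * Real.exp (-(σ / 2) * s)‖ ≤ M * Real.exp (-(σ / 2) * s) :=
    Filter.Eventually.of_forall fun s _ ρ _ => by
      rw [Real.norm_eq_abs, abs_mul, abs_of_pos (Real.exp_pos _)]
      exact mul_le_mul_of_nonneg_right (hM _) (Real.exp_pos _).le
  have bound_integrable : IntervalIntegrable (fun s : ℝ => M * Real.exp (-(σ / 2) * s)) volume 0 t :=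
    (show Continuous fun s : ℝ => M * Real.exp (-(σ / 2) * s) by fun_prop).intervalIntegrable _ _
  have h_diff : ∀ᵐ s ∂volume, s ∈ Set.uIoc (0 : ℝ) t → ∀ ρ ∈ (univ : Set ℝ),
      HasDerivAt (fun ρ : ℝ => Ω (ρ * Real.exp (-(σ / 2) * s)))
        (Ω' (ρ * Real.exp (-(σ / 2) * s)) * Real.exp (-(σ / 2) * s)) ρ :=
    Filter.Eventually.of_forall fun s _ ρ _ => by
      have h1 : HasDerivAt (fun ρ : ℝ => ρ * Real.exp (-(σ / 2) * s)) (Real.exp (-(σ / 2) * s)) ρ := by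
        simpa using (hasDerivAt_id ρ).mul_const (Real.exp (-(σ / 2) * s))
      exact (hΩ _).comp ρ h1
  have h := (intervalIntegral.hasDerivAt_integral_of_dominated_loc_of_deriv_le
    (Filter.univ_mem) hF_meas hF_int hF'_meas h_bound bound_integrable h_diff).2
  simpa using h.const_add θ₀

/-- **The shear entry for a `C¹` swirl.** Combining `hasDerivAt_angle_radius` with `shear_sq_le`:
the `(θ, r)` entry `b(t) = r(t) · ∂θ/∂r₀` of the flow-map differential satisfies
`b(t)² ≤ (2 r₀ M/σ)² e^{−σt}`-type control, precisely `b² ≤ K² (e^{−σt/2})²`, `K = 2 r₀ sup|Ω′|/σ`,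
for all `t ≥ 0`: Lundgren winding is algebraic (a bounded factor), never exponential. -/
theorem swirl_shear_sq_le {Ω' : ℝ → ℝ} (hΩ' : Continuous Ω') {M σ t r₀ : ℝ} (hM : ∀ x, |Ω' x| ≤ M)
    (hσ : 0 < σ) (ht : 0 ≤ t) (hr : 0 ≤ r₀) :
    (r₀ * Real.exp (-(σ / 2) * t) *
        ∫ s in (0 : ℝ)..t, Ω' (r₀ * Real.exp (-(σ / 2) * s)) * Real.exp (-(σ / 2) * s)) ^ 2
      ≤ (2 * r₀ * M / σ) ^ 2 * Real.exp (-(σ / 2) * t) ^ 2 := by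
  have hg : IntervalIntegrable (fun s : ℝ => Ω' (r₀ * Real.exp (-(σ / 2) * s))) volume 0 t :=
    (show Continuous fun s : ℝ => Ω' (r₀ * Real.exp (-(σ / 2) * s)) by fun_prop).intervalIntegrable _ _
  exact shear_sq_le hσ ht hr hg fun s _ => hM _

end SwirlDerivative

end Summit.NavierStokesRegularity.FluidComputer.BurgersColumnarFlowMap
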